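import Summits.ResolutionOfSingularities.ResolutionOfSingularities.Theses.Descent
import Literature.AlgebraicGeometry.Resolution.QuasiProjectiveReduction

/-!
# Rung B, piece B0: embedded resolution in smooth irreducible ambients over a field `K` gives
# resolution of every reduced separated `K`-scheme of finite type

Route `ResolutionOfSingularities/Descent`, helper toward the crux `DescentPerfectToAll`
(stmt-ResolutionOfSingularities-0549). OURS (LADDER-RESOLUTION rung B, cell res-hironaka,
plan/RUNG-B.md v0.1 §2, piece `B0 p := EmbeddedSmoothResPerfect p → PerfectRes p`, GAP row G8-b);
it replaces the role of no printed item and is NOT a statement of any manuscript. The antecedent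
shape `EmbeddedSmoothResPerfect` is the consequence-shape a bridge would CONSUME from a candidate
embedded-resolution statement; nothing about any candidate is asserted here.

**Statement (fixed field, any characteristic).** Let `K` be a field. Suppose that for every smooth,
irreducible, separated, quasi-compact `K`-scheme `Z` (locally of finite type) and every INTEGRAL
closed subscheme `i : X ↪ Z`, the scheme `X` has a resolution of singularities
(`Scheme.HasResolution`: a proper birational regular model). Then every reduced separated
`K`-scheme of finite type has a resolution of singularities.

**Proof.** The tree's Chow reduction `hasResolution_of_forall_closedImmersion_opens_projectiveSpace`
(`QuasiProjectiveReduction.lean`: resolve the irreducible components with their reduced structure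
and glue, `hasResolution_of_forall_closeds`; Chow's lemma `ChowLemmaIntegral_holds` dominates an
integral separated `X` of finite type properly-birationally by an integral `X'` immersed in some
`𝐏ⁿ_K`, i.e. closed in an open `U ⊆ 𝐏ⁿ_K`; transport along proper birational maps) leaves to show
that the ambient `U` qualifies: `U → Spec K` is smooth, separated and quasi-compact
(`smooth_isSeparated_quasiCompact_isRegular_opens_projectiveSpace`), and `U` is irreducible, being
a NON-EMPTY (it contains the image of the integral, hence non-empty, `X'`) open subscheme of the
integral scheme `𝐏ⁿ_K` (`isIntegral_projectiveSpace`, Mathlib `isIntegral_of_isOpenImmersion`).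
Perfectness of `K` and the characteristic play no role in this glue; the `p`-quantified form
`B0 p` of plan/RUNG-B.md (perfect fields of characteristic `p` on both sides) is the special case
`rungB0`.

## Content (namespace `Summit.ResolutionOfSingularities.ResolutionOfSingularities.Theorems`)

* `hasResolution_of_forall_closedImmersion_smooth_irreducible` — the fixed-field statement above.
* `rungB0` — `∀ p, EmbeddedSmoothResPerfect p → PerfectRes p` with both `Prop`s written out
  (their named forms are not yet in the tree; the binder lists below are verbatim those of
  plan/RungB.lean v0.1, so the named `B0 p` will be this theorem by `fun p => rungB0 p`).
-/

noncomputable section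

set_option linter.dupNamespace false -- mandated namespace of this single-conjunct summit

open CategoryTheory AlgebraicGeometry TopologicalSpace
open Literature.AlgebraicGeometry Literature.AlgebraicGeometry.Resolution

namespace Summit.ResolutionOfSingularities.ResolutionOfSingularities.Theorems

/-- **Embedded resolution in smooth irreducible ambients suffices** (fixed field `K`, any
characteristic): if every integral closed subscheme `i : X ↪ Z` of every smooth irreducible
separated quasi-compact `K`-scheme `g : Z → Spec K` has a resolution of singularities, then so does
every reduced separated `K`-scheme of finite type. Chow's lemma puts an integral `X` (up to a proper
birational modification) as a closed subscheme of a non-empty open `U ⊆ 𝐏ⁿ_K`, which is smooth,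
separated, quasi-compact and irreducible. [cite: Kollar2007, Thm. 3.36 from Cor. 3.22 (pp. 124, 132)] -/
theorem hasResolution_of_forall_closedImmersion_smooth_irreducible {K : Type} [Field K]
    (h : ∀ (Z X : Scheme.{0}) (g : Z ⟶ Spec (.of K)) (i : X ⟶ Z),
      IsSeparated g → LocallyOfFiniteType g → QuasiCompact g → Smooth g → IrreducibleSpace Z →
        IsClosedImmersion i → IsIntegral X → Scheme.HasResolution X)
    (X : Scheme.{0}) (f : X ⟶ Spec (.of K)) [IsSeparated f] [LocallyOfFiniteType f]
    [QuasiCompact f] [IsReduced X] : Scheme.HasResolution X := by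
  refine hasResolution_of_forall_closedImmersion_opens_projectiveSpace
    (fun n U X' i hi hint' => ?_) X f
  obtain ⟨hs, hsep, hqc, -⟩ := smooth_isSeparated_quasiCompact_isRegular_opens_projectiveSpace n U
  haveI := hs
  haveI := hi
  haveI := hint'
  -- `U` is a non-empty open subscheme of the integral `𝐏ⁿ_K`, hence integral, hence irreducible
  haveI : Nonempty (U : Scheme.{0}) := ⟨i.base (Classical.arbitrary X')⟩
  haveI := isIntegral_projectiveSpace n K
  haveI : IsIntegral (U : Scheme.{0}) := isIntegral_of_isOpenImmersion U.ι
  exact h U X' (U.ι ≫ (Motives.projectiveSpace n K).hom) i hsep inferInstance hqc hs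
    inferInstance hi hint'

/-- **Rung B, piece B0** (`∀ p, EmbeddedSmoothResPerfect p → PerfectRes p` of plan/RUNG-B.md v0.1,
both `Prop`s unfolded verbatim): for every `p`, if every integral closed subscheme of every smooth
irreducible separated quasi-compact scheme (locally of finite type) over every PERFECT field of
characteristic `p` has a resolution, then every reduced separated scheme of finite type over every
perfect field of characteristic `p` has one. Field by field this is
`hasResolution_of_forall_closedImmersion_smooth_irreducible`; `p`, `CharP` and `PerfectField` are
carried, not used. [folklore] -/
theorem rungB0 (p : ℕ) :
    (∀ (K : Type) [Field K] [CharP K p] [PerfectField K] (Z X : Scheme.{0})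
        (g : Z ⟶ Spec (.of K)) (i : X ⟶ Z),
        IsSeparated g → LocallyOfFiniteType g → QuasiCompact g → Smooth g → IrreducibleSpace Z →
          IsClosedImmersion i → IsIntegral X → Scheme.HasResolution X) →
    ∀ (K : Type) [Field K] [CharP K p] [PerfectField K] (X : Scheme.{0}) (f : X ⟶ Spec (.of K)),
      IsSeparated f → LocallyOfFiniteType f → QuasiCompact f → IsReduced X →
        Scheme.HasResolution X :=
  fun hE K _ _ _ X f _ _ _ _ =>
    hasResolution_of_forall_closedImmersion_smooth_irreducible (K := K) (hE K) X f

end Summit.ResolutionOfSingularities.ResolutionOfSingularities.Theorems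

end
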